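import Literature.Geometry.Lorentzian.StationaryOrbitQuotientMetricSmooth
import HarnessLib

/-!
# The quotient metric `g_S` as a Riemannian metric on the orbit 3-manifold
(Anderson 2000, §0: "`g_M` restricted to the horizontal subspaces … induces a Riemannian metric
`g_S` on `S`" — the bundled object)

For a chronological stationary spacetime `𝓢` (bundled, four-dimensional) with stationary Killing
field `X`, the orbit space `S = OrbitSpace X` is a `C^∞` 3-manifold (slice charts,
`StationaryOrbitSpaceManifold.lean`), the quotient metric `g_S(z)(ζ, ζ') = g(H ζ, H ζ')` is a
Euclidean inner product on each tangent space `T_z S = ℝ³` (`StationaryOrbitQuotientMetric.lean`)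
and its coordinate expression in every slice chart is `C^∞`
(`StationaryOrbitQuotientMetricSmooth.lean`). This file packages these into the prelude's bundled
notion:

* `Spacetime.IsStationaryKilling.quotientMetricCLM hX hchr z` — `g_S(z)` as a continuous bilinear
  form `ℝ³ →L[ℝ] ℝ³ →L[ℝ] ℝ` (`quotientMetricCLM_apply`);
* `Spacetime.IsStationaryKilling.trivializationAt_quotientMetricCLM` — the section `z ↦ g_S(z)` of
  the bundle of bilinear forms on `TS`, read in the trivialization at `z₀`, is the coordinate
  expression of `g_S` in the slice chart at `z₀` (Mathlib's `inCoordinates_apply_eq₂` and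
  `TangentBundle.symmL_trivializationAt`);
* `Spacetime.IsStationaryKilling.contMDiff_quotientMetricCLM` — hence **`z ↦ g_S(z)` is a `C^∞`
  section** of `Hom(TS, Hom(TS, ℝ))`;
* `Spacetime.IsStationaryKilling.quotientMetric hX hchr` — **`g_S` as a
  `PseudoRiemannianMetric (𝓡 3) ∞ ℝ³ (TangentSpace (𝓡 3) : OrbitSpace X → Type _)`** (symmetric,
  nondegenerate, `C^∞`), and `quotientMetric_pos` — **it is Riemannian** (positive definite):
  Anderson's `(S, g_S)`.

No named facts; the definitions depend on `hX`, `hchr` and choices, like the charted-space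
structure they live on.

## References

* M. T. Anderson, Ann. Henri Poincaré 1 (2000) 977–994, arXiv:gr-qc/0001091, §0 (key
  `Anderson2000`).
* B. O'Neill, *Semi-Riemannian geometry* (1983), Ch. 7, Def. 7.44 ff. (semi-Riemannian
  submersions: the base metric) (key `ONeill1983`).
-/

noncomputable section

open Bundle Set Filter Function Manifold TopologicalSpace
open scoped ContDiff Topology Manifold

namespace Literature.Geometry.Lorentzian

namespace Spacetime

universe u

variable {𝓢 : Spacetime.{u} 4} [𝓢.metric.HasLeviCivita]
  {X : Π x : 𝓢.carrier, TangentSpace (𝓡 4) x}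

/-! ### `g_S(z)` as a continuous bilinear form -/

/-- `g_S(z)` as a bilinear map `ℝ³ →ₗ ℝ³ →ₗ ℝ` (`quotientMetricVal` is bilinear:
`quotientMetricVal_add_left`, `quotientMetricVal_smul_left`, symmetry). [cite: Anderson2000, §0] -/
def IsStationaryKilling.quotientMetricBilin (hX : 𝓢.IsStationaryKilling X univ)
    (hchr : 𝓢.metric.IsChronological 𝓢.timeOrientation) (z : OrbitSpace X) :
    EuclideanSpace ℝ (Fin 3) →ₗ[ℝ] EuclideanSpace ℝ (Fin 3) →ₗ[ℝ] ℝ :=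
  LinearMap.mk₂ ℝ (hX.quotientMetricVal hchr z)
    (fun a a' b ↦ hX.quotientMetricVal_add_left hchr z a a' b)
    (fun c a b ↦ by rw [hX.quotientMetricVal_smul_left, smul_eq_mul])
    (fun a b b' ↦ by
      rw [hX.quotientMetricVal_symm hchr z a, hX.quotientMetricVal_add_left,
        hX.quotientMetricVal_symm hchr z b, hX.quotientMetricVal_symm hchr z b'])
    (fun c a b ↦ by
      rw [hX.quotientMetricVal_symm hchr z a, hX.quotientMetricVal_smul_left,
        hX.quotientMetricVal_symm hchr z b, smul_eq_mul])

/-- **`g_S(z)` as a continuous bilinear form** `ℝ³ →L[ℝ] ℝ³ →L[ℝ] ℝ` on `T_z S = ℝ³` (finite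
dimension). Anderson 2000, §0. [cite: Anderson2000, §0] -/
def IsStationaryKilling.quotientMetricCLM (hX : 𝓢.IsStationaryKilling X univ)
    (hchr : 𝓢.metric.IsChronological 𝓢.timeOrientation) (z : OrbitSpace X) :
    EuclideanSpace ℝ (Fin 3) →L[ℝ] EuclideanSpace ℝ (Fin 3) →L[ℝ] ℝ :=
  LinearMap.toContinuousLinearMap
    ((LinearMap.toContinuousLinearMap :
        (EuclideanSpace ℝ (Fin 3) →ₗ[ℝ] ℝ) ≃ₗ[ℝ] EuclideanSpace ℝ (Fin 3) →L[ℝ] ℝ).toLinearMap ∘ₗ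
      hX.quotientMetricBilin hchr z)

/-- Unfolding lemma: `quotientMetricCLM z a b = g_S(z)(a, b)`. [folklore] -/
@[simp]
theorem IsStationaryKilling.quotientMetricCLM_apply (hX : 𝓢.IsStationaryKilling X univ)
    (hchr : 𝓢.metric.IsChronological 𝓢.timeOrientation) (z : OrbitSpace X)
    (a b : EuclideanSpace ℝ (Fin 3)) :
    hX.quotientMetricCLM hchr z a b = hX.quotientMetricVal hchr z a b := rfl

/-! ### Smoothness of the section `z ↦ g_S(z)` -/

/-- **`g_S` read in the trivialization at `z₀` is its coordinate expression in the slice chart at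
`z₀`.** For `z` in the source of the chart `e = chartAt z₀` and `a, b ∈ ℝ³`, the section
`z ↦ g_S(z)` of the bundle `Hom(TS, Hom(TS, ℝ))`, trivialized at `z₀` and evaluated at `(a, b)`, is
`g_S(z)(d(e⁻¹)_{e z} a, d(e⁻¹)_{e z} b)` (Mathlib: `hom_trivializationAt_apply`,
`inCoordinates_apply_eq₂`, `TangentBundle.symmL_trivializationAt`). [folklore] -/
theorem IsStationaryKilling.trivializationAt_quotientMetricCLM (hX : 𝓢.IsStationaryKilling X univ)
    (hchr : 𝓢.metric.IsChronological 𝓢.timeOrientation) (z₀ : OrbitSpace X) :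
    letI := hX.orbitSpaceChartedSpace hchr
    haveI := (hX.isManifold_orbitSpace hchr).1
    ∀ {z : OrbitSpace X}, z ∈ (chartAt (EuclideanSpace ℝ (Fin 3)) z₀).source →
    ∀ a b : EuclideanSpace ℝ (Fin 3),
      (trivializationAt (EuclideanSpace ℝ (Fin 3) →L[ℝ] EuclideanSpace ℝ (Fin 3) →L[ℝ] ℝ)
        (fun z : OrbitSpace X ↦ TangentSpace (𝓡 3) z →L[ℝ] TangentSpace (𝓡 3) z →L[ℝ] ℝ) z₀
        ⟨z, hX.quotientMetricCLM hchr z⟩).2 a b =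
      hX.quotientMetricVal hchr z
        (mfderiv (𝓡 3) (𝓡 3) (chartAt (EuclideanSpace ℝ (Fin 3)) z₀).symm
          (chartAt (EuclideanSpace ℝ (Fin 3)) z₀ z) a)
        (mfderiv (𝓡 3) (𝓡 3) (chartAt (EuclideanSpace ℝ (Fin 3)) z₀).symm
          (chartAt (EuclideanSpace ℝ (Fin 3)) z₀ z) b) := by
  letI := hX.orbitSpaceChartedSpace hchr
  haveI := (hX.isManifold_orbitSpace hchr).1
  intro z hz a b
  have hz' : z ∈ (trivializationAt (EuclideanSpace ℝ (Fin 3))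
      (TangentSpace (𝓡 3) : OrbitSpace X → Type _) z₀).baseSet := by
    simpa using hz
  -- the inverse tangent trivialization is the derivative of the inverse chart
  have hext : ∀ c : EuclideanSpace ℝ (Fin 3),
      mfderivWithin (𝓡 3) (𝓡 3) (extChartAt (𝓡 3) z₀).symm (range (𝓡 3))
        (extChartAt (𝓡 3) z₀ z) c =
      mfderiv (𝓡 3) (𝓡 3) (chartAt (EuclideanSpace ℝ (Fin 3)) z₀).symm
        (chartAt (EuclideanSpace ℝ (Fin 3)) z₀ z) c := by
    intro c
    rw [ModelWithCorners.Boundaryless.range_eq_univ, mfderivWithin_univ]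
    rfl
  have hsymm : ∀ c : EuclideanSpace ℝ (Fin 3),
      (trivializationAt (EuclideanSpace ℝ (Fin 3)) (TangentSpace (𝓡 3) : OrbitSpace X → Type _)
        z₀).symm z c =
      mfderiv (𝓡 3) (𝓡 3) (chartAt (EuclideanSpace ℝ (Fin 3)) z₀).symm
        (chartAt (EuclideanSpace ℝ (Fin 3)) z₀ z) c := by
    intro c
    rw [← Trivialization.symmL_apply (R := ℝ) _ hz', TangentBundle.symmL_trivializationAt hz]
    exact hext c
  rw [hom_trivializationAt_apply, inCoordinates_apply_eq₂ hz' hz' (by simp)]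
  dsimp only
  rw [Trivialization.coe_linearMapAt_of_mem _ (by simp), hsymm a, hsymm b]
  rfl

/-- `(2 : ℕ∞ω) ≤ ∞`. [folklore] -/
private lemma two_le_infty_r : (2 : ℕ∞ω) ≤ ∞ := WithTop.coe_le_coe.mpr le_top

/-- `dim ℝ³ + 1 = dim ℝ⁴`. [folklore] -/
private lemma finrank_three_add_one_r :
    Module.finrank ℝ (EuclideanSpace ℝ (Fin 3)) + 1 =
      Module.finrank ℝ (EuclideanSpace ℝ (Fin 4)) := by
  simp [finrank_euclideanSpace]

/-- **`z ↦ g_S(z)` is a `C^∞` section of the bundle of bilinear forms on `TS`.** At `z₀`, read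
in the trivialization at `z₀` and in the slice chart `e = chartAt z₀` (`e⁻¹ = π ∘ σ`), the section
is `u ↦ ((a, b) ↦ g_S(e⁻¹ u)(d(e⁻¹)_u a, d(e⁻¹)_u b))` (`trivializationAt_quotientMetricCLM`),
whose entries are `C^∞` on the chart target (`contMDiffOn_quotientMetricVal_chart_symm`); a map
into the finite-dimensional space of bilinear forms is `C^∞` iff its entries are
(`contDiffOn_clm_apply`). Anderson 2000, §0 ("induces a Riemannian metric `g_S` on `S`").
[cite: Anderson2000, §0] -/
theorem IsStationaryKilling.contMDiff_quotientMetricCLM (hX : 𝓢.IsStationaryKilling X univ)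
    (hchr : 𝓢.metric.IsChronological 𝓢.timeOrientation) :
    letI := hX.orbitSpaceChartedSpace hchr
    haveI := (hX.isManifold_orbitSpace hchr).1
    ContMDiff (𝓡 3) ((𝓡 3).prod 𝓘(ℝ, EuclideanSpace ℝ (Fin 3) →L[ℝ] EuclideanSpace ℝ (Fin 3) →L[ℝ] ℝ))
      ∞ (fun z ↦ TotalSpace.mk' (EuclideanSpace ℝ (Fin 3) →L[ℝ] EuclideanSpace ℝ (Fin 3) →L[ℝ] ℝ)
        (E := fun z : OrbitSpace X ↦ TangentSpace (𝓡 3) z →L[ℝ] TangentSpace (𝓡 3) z →L[ℝ] ℝ)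
        z (hX.quotientMetricCLM hchr z)) := by
  letI := hX.orbitSpaceChartedSpace hchr
  haveI := (hX.isManifold_orbitSpace hchr).1
  intro z₀
  rw [contMDiffAt_section,
    contMDiffAt_iff_source_of_mem_source (I := 𝓡 3) (mem_chart_source _ z₀),
    ModelWithCorners.Boundaryless.range_eq_univ, contMDiffWithinAt_univ]
  -- the slice chart at `z₀` and its slice data
  set e := chartAt (EuclideanSpace ℝ (Fin 3)) z₀ with he
  set d : LorentzianMetric.SliceData X hX.flow (EuclideanSpace ℝ (Fin 3)) z₀.out :=
    LorentzianMetric.IsStationaryKilling.sliceDataAt hX hchr (hX.contMDiff_flow.of_le two_le_infty_r)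
      hX.flow_zero hX.flow_add hX.isMIntegralCurve_flow finrank_three_add_one_r z₀.out with hd
  -- the trivialized section composed with `e⁻¹` is `C^∞` on the chart target, entry by entry
  have hOn : ContMDiffOn 𝓘(ℝ, EuclideanSpace ℝ (Fin 3))
      𝓘(ℝ, EuclideanSpace ℝ (Fin 3) →L[ℝ] EuclideanSpace ℝ (Fin 3) →L[ℝ] ℝ) ∞
      (fun u ↦ (trivializationAt (EuclideanSpace ℝ (Fin 3) →L[ℝ] EuclideanSpace ℝ (Fin 3) →L[ℝ] ℝ)
        (fun z : OrbitSpace X ↦ TangentSpace (𝓡 3) z →L[ℝ] TangentSpace (𝓡 3) z →L[ℝ] ℝ) z₀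
        ⟨(extChartAt (𝓡 3) z₀).symm u,
          hX.quotientMetricCLM hchr ((extChartAt (𝓡 3) z₀).symm u)⟩).2) e.target := by
    rw [contMDiffOn_iff_contDiffOn]
    refine contDiffOn_clm_apply.2 (fun a ↦ contDiffOn_clm_apply.2 (fun b ↦ ?_))
    have hsmooth := hX.contMDiffOn_quotientMetricVal_chart_symm hchr d a b
    rw [contMDiffOn_iff_contDiffOn] at hsmooth
    refine hsmooth.congr (fun u hu ↦ ?_)
    have hzu : (extChartAt (𝓡 3) z₀).symm u ∈ e.source := e.map_target hu
    have key := hX.trivializationAt_quotientMetricCLM hchr z₀ hzu a b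
    rw [show chartAt (EuclideanSpace ℝ (Fin 3)) z₀ ((extChartAt (𝓡 3) z₀).symm u) = u from
      e.right_inv hu] at key
    exact key
  have hu₀ : extChartAt (𝓡 3) z₀ z₀ ∈ e.target := by
    simpa using e.map_source (mem_chart_source _ z₀)
  exact hOn.contMDiffAt (e.open_target.mem_nhds hu₀)

/-! ### `g_S` as a Riemannian metric on `S` -/

/-- **Anderson's quotient metric `g_S` as a bundled `C^∞` pseudo-Riemannian metric on the orbit
3-manifold** `S = OrbitSpace X` of a chronological stationary spacetime: `g_S(z)(ζ, ζ') =
g(H ζ, H ζ')` (`quotientMetricVal`), symmetric, nondegenerate (indeed positive definite,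
`isRiemannian_quotientMetric`) and `C^∞` as a section of the bundle of bilinear forms on `TS`
(`contMDiff_quotientMetricCLM`). Anderson 2000, §0: "The metric `g = g_M` restricted to the
horizontal subspaces of `TM` … then induces a Riemannian metric `g_S` on `S`."
[cite: Anderson2000, §0] -/
def IsStationaryKilling.quotientMetric (hX : 𝓢.IsStationaryKilling X univ)
    (hchr : 𝓢.metric.IsChronological 𝓢.timeOrientation) :
    letI := hX.orbitSpaceChartedSpace hchr
    haveI := (hX.isManifold_orbitSpace hchr).1
    PseudoRiemannianMetric (𝓡 3) ∞ (EuclideanSpace ℝ (Fin 3))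
      (TangentSpace (𝓡 3) : OrbitSpace X → Type _) :=
  letI := hX.orbitSpaceChartedSpace hchr
  haveI := (hX.isManifold_orbitSpace hchr).1
  { val := fun z ↦ hX.quotientMetricCLM hchr z
    symm := fun z v w ↦ hX.quotientMetricVal_symm hchr z v w
    nondegenerate := fun z v hv ↦ (hX.quotientMetricVal_self_eq_zero_iff hchr z v).1 (hv v)
    contMDiff := hX.contMDiff_quotientMetricCLM hchr }

/-- Unfolding lemma: `(g_S).val z a b = quotientMetricVal z a b`. [folklore] -/
@[simp]
theorem IsStationaryKilling.quotientMetric_val_apply (hX : 𝓢.IsStationaryKilling X univ)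
    (hchr : 𝓢.metric.IsChronological 𝓢.timeOrientation) (z : OrbitSpace X)
    (a b : EuclideanSpace ℝ (Fin 3)) :
    letI := hX.orbitSpaceChartedSpace hchr
    haveI := (hX.isManifold_orbitSpace hchr).1
    (hX.quotientMetric hchr).val z a b = hX.quotientMetricVal hchr z a b := rfl

/-- **`g_S` is Riemannian** (positive definite on every tangent space of `S`): the horizontal
subspaces are spacelike (`quotientMetricVal_self_pos`). Anderson 2000, §0 ("a Riemannian metric
`g_S` on `S`"). [cite: Anderson2000, §0] -/
theorem IsStationaryKilling.isRiemannian_quotientMetric (hX : 𝓢.IsStationaryKilling X univ)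
    (hchr : 𝓢.metric.IsChronological 𝓢.timeOrientation) :
    letI := hX.orbitSpaceChartedSpace hchr
    haveI := (hX.isManifold_orbitSpace hchr).1
    (hX.quotientMetric hchr).IsRiemannian := by
  letI := hX.orbitSpaceChartedSpace hchr
  haveI := (hX.isManifold_orbitSpace hchr).1
  exact fun z _ hv ↦ hX.quotientMetricVal_self_pos hchr z hv

/-- **`π` is a (pseudo-)Riemannian submersion onto `(S, g_S)`: `π^* g_S = h`**, Geroch's orbit
form `g − λ⁻¹ X♭ ⊗ X♭` on `M` (`quotientMetricVal_mfderiv_orbitProj`). [cite: Anderson2000, §0] -/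
theorem IsStationaryKilling.quotientMetric_val_mfderiv_orbitProj
    (hX : 𝓢.IsStationaryKilling X univ) (hchr : 𝓢.metric.IsChronological 𝓢.timeOrientation)
    (y : 𝓢.carrier) (v w : TangentSpace (𝓡 4) y) :
    letI := hX.orbitSpaceChartedSpace hchr
    haveI := (hX.isManifold_orbitSpace hchr).1
    (hX.quotientMetric hchr).val (orbitProj X y) (mfderiv (𝓡 4) (𝓡 3) (orbitProj X) y v)
        (mfderiv (𝓡 4) (𝓡 3) (orbitProj X) y w) =
      𝓢.metric.toPseudoRiemannianMetric.orbitBilin X y v w :=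
  hX.quotientMetricVal_mfderiv_orbitProj hchr y v w

end Spacetime

end Literature.Geometry.Lorentzian

end
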